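import Mathlib
import HarnessLib

/-!
# Format C, design C∞: iterated Abel summation for the oscillatory tail sums `Σ_{m≥m₀} w(m) z^m`

Route context: Fourier–Galerkin / Schur-complement certificates of Weil positivity on a window ("format C", design C∞;
cell memo `run/shared/lean/pub/rh-explicit/rh-explicit-weil-2/gen9/CINF-DOOR-SIZING.md` §9–§10, item E1; supporting
stmt-RiemannHypothesis-0098; seat rh-explicit-weil-2, (E) side of the C∞ door of rh-explicit-weil-10).

The MS-Gram of the C∞ coupling tail (`WeilFormatCFamilyGram`) needs TIGHT two-sided boxes for the oscillatory entries
`Σ_{m≥m₀} cos(mφ)/m^s`, `Σ_{m≥m₀} sin(mφ)/m^s` (one-step Abel radii of relative size `(m₀|sin(φ/2)|)^{−1}` are too coarse in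
non-critical directions: dress rehearsal kit j193594 vs j193782).  `K`-fold summation by parts gives them to any accuracy with
ELEMENTARY data: for `z ≠ 1`, `‖z‖ = 1` and an absolutely summable weight `w`,

  `Σ'_{k} w(m₀+k) z^{m₀+k} = (Σ_{j<K} (z/(1−z))^j (Δ^j w)(m₀)) z^{m₀}/(1−z) + (z/(1−z))^K Σ'_k (Δ^K w)(m₀+k) z^{m₀+k}`

(`Δ` = forward difference `fwdDiff 1`), and the last series is bounded by `|Δ^{K−1}w(m₀)|` as soon as `Δ^{K−1}w` is monotone of
constant sign beyond `m₀` and tends to `0` — which holds for `w(m) = 1/m^s` by complete monotonicity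
(`(−1)^K Δ^K (1/m^s) = Γ(s)⁻¹ ∫_0^∞ t^{s−1} e^{−mt} (1−e^{−t})^K dt ≥ 0`).

* `abel_step`, `abel_iter` — the summation-by-parts identities (complex weights);
* `norm_tsum_shift_mul_pow_le` — `‖Σ' v(m₀+k) z^{m₀+k}‖ ≤ Σ' ‖v(m₀+k)‖`;
* `tsum_abs_fwdDiff_eq_of_antitone` — telescoping: `Σ'_k |u(m₀+k+1) − u(m₀+k)| = |u(m₀)|` for monotone `u → 0`;
* `fwdDiff_iter_inv_pow_eq_integral`, `fwdDiff_iter_inv_pow_sign` — complete monotonicity of `1/m^s`;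
* `norm_oscTail_inv_pow_sub_abel_le` — the box: main term as above, radius `|Δ^{K−1}(1/m^s)(m₀)|/‖1−z‖^K`.

Elementary; standard axioms; no definitions; no RH claim.
-/

-- `Summit.RiemannHypothesis.RiemannHypothesis.…` is the layout-mandated namespace (summit = problem name).
set_option linter.dupNamespace false

noncomputable section

open Filter Set MeasureTheory fwdDiff
open scoped Topology

namespace Summit.RiemannHypothesis.RiemannHypothesis.Theorems.WeilFormatC

/-! ## Summability plumbing -/

section Summable

variable {w : ℕ → ℂ}

/-- Iterated forward differences of an absolutely summable sequence are absolutely summable (any shift). -/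
theorem summable_norm_fwdDiff_iter_shift (hw : Summable fun n ↦ ‖w n‖) (j m₀ : ℕ) :
    Summable fun k ↦ ‖((Δ_[1])^[j] w) (m₀ + k)‖ := by
  -- `Δ^j w (y) = Σ_{i ≤ j} c_i • w (y + i)`
  have hrepr : ∀ y, ((Δ_[1])^[j] w) y = ∑ i ∈ Finset.range (j + 1), (((-1 : ℤ) ^ (j - i) * j.choose i : ℤ) : ℂ) * w (y + i) := by
    intro y
    rw [fwdDiff_iter_eq_sum_shift]
    refine Finset.sum_congr rfl fun i _ ↦ ?_
    rw [zsmul_eq_mul, smul_eq_mul, mul_one]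
  have hs : ∀ i, Summable fun k ↦ ‖(((-1 : ℤ) ^ (j - i) * j.choose i : ℤ) : ℂ) * w (m₀ + k + i)‖ := by
    intro i
    simp_rw [norm_mul]
    refine Summable.mul_left _ ?_
    have := (summable_nat_add_iff (m₀ + i)).2 hw
    refine this.congr fun k ↦ ?_
    ring_nf
  refine Summable.of_nonneg_of_le (fun k ↦ norm_nonneg _) (fun k ↦ ?_) (summable_sum fun i (_ : i ∈ Finset.range (j + 1)) ↦ hs i)
  rw [hrepr]
  exact norm_sum_le _ _

/-- The twisted series `k ↦ v(m₀+k) z^{m₀+k}` is summable when `Σ‖v(m₀+k)‖ < ∞` and `‖z‖ = 1`. -/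
theorem summable_shift_mul_pow {v : ℕ → ℂ} {z : ℂ} (hz : ‖z‖ = 1) {m₀ : ℕ} (hv : Summable fun k ↦ ‖v (m₀ + k)‖) :
    Summable fun k ↦ v (m₀ + k) * z ^ (m₀ + k) := by
  refine Summable.of_norm_bounded hv (fun k ↦ ?_)
  rw [norm_mul, norm_pow, hz, one_pow, mul_one]

/-- `‖Σ' v(m₀+k) z^{m₀+k}‖ ≤ Σ' ‖v(m₀+k)‖` for `‖z‖ = 1`. -/
theorem norm_tsum_shift_mul_pow_le {v : ℕ → ℂ} {z : ℂ} (hz : ‖z‖ = 1) {m₀ : ℕ} (hv : Summable fun k ↦ ‖v (m₀ + k)‖) :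
    ‖∑' k, v (m₀ + k) * z ^ (m₀ + k)‖ ≤ ∑' k, ‖v (m₀ + k)‖ := by
  refine tsum_of_norm_bounded hv.hasSum fun k ↦ ?_
  rw [norm_mul, norm_pow, hz, one_pow, mul_one]

end Summable

/-! ## Summation by parts -/

section Abel

variable {w : ℕ → ℂ} {z : ℂ}

/-- **One Abel step**: `(1 − z)·Σ' w(m₀+k)z^{m₀+k} = w(m₀) z^{m₀} + z·Σ' (Δw)(m₀+k) z^{m₀+k}`. -/
theorem abel_step (hz : ‖z‖ = 1) (hw : Summable fun n ↦ ‖w n‖) (m₀ : ℕ) :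
    (1 - z) * ∑' k, w (m₀ + k) * z ^ (m₀ + k)
      = w m₀ * z ^ m₀ + z * ∑' k, (Δ_[1] w) (m₀ + k) * z ^ (m₀ + k) := by
  have hs0 : Summable fun k ↦ w (m₀ + k) * z ^ (m₀ + k) :=
    summable_shift_mul_pow hz (by simpa using summable_norm_fwdDiff_iter_shift hw 0 m₀)
  have hs1 : Summable fun k ↦ w (m₀ + k + 1) * z ^ (m₀ + k + 1) := by
    have := (summable_nat_add_iff 1).2 hs0
    refine this.congr fun k ↦ ?_
    simp only [add_assoc]
  have hsd : Summable fun k ↦ (Δ_[1] w) (m₀ + k) * z ^ (m₀ + k) :=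
    summable_shift_mul_pow hz (summable_norm_fwdDiff_iter_shift hw 1 m₀)
  -- `T = w m₀ z^m₀ + Σ' w(m₀+k+1) z^{m₀+k+1}`
  have hsplit : ∑' k, w (m₀ + k) * z ^ (m₀ + k) = w m₀ * z ^ m₀ + ∑' k, w (m₀ + k + 1) * z ^ (m₀ + k + 1) := by
    rw [hs0.tsum_eq_zero_add]
    simp only [add_zero, add_assoc]
  -- `z·T = Σ' w(m₀+k) z^{m₀+k+1}`
  have hzT : z * ∑' k, w (m₀ + k) * z ^ (m₀ + k) = ∑' k, w (m₀ + k) * z ^ (m₀ + k + 1) := by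
    rw [← tsum_mul_left]; refine tsum_congr fun k ↦ ?_; ring
  have hs2 : Summable fun k ↦ w (m₀ + k) * z ^ (m₀ + k + 1) := by
    have := hs0.mul_left z
    refine this.congr fun k ↦ ?_; ring
  calc (1 - z) * ∑' k, w (m₀ + k) * z ^ (m₀ + k)
      = ∑' k, w (m₀ + k) * z ^ (m₀ + k) - z * ∑' k, w (m₀ + k) * z ^ (m₀ + k) := by ring
    _ = (w m₀ * z ^ m₀ + ∑' k, w (m₀ + k + 1) * z ^ (m₀ + k + 1)) - ∑' k, w (m₀ + k) * z ^ (m₀ + k + 1) := by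
        rw [hzT]; rw [hsplit]
    _ = w m₀ * z ^ m₀ + ∑' k, (w (m₀ + k + 1) * z ^ (m₀ + k + 1) - w (m₀ + k) * z ^ (m₀ + k + 1)) := by
        rw [hs1.tsum_sub hs2]; ring
    _ = w m₀ * z ^ m₀ + z * ∑' k, (Δ_[1] w) (m₀ + k) * z ^ (m₀ + k) := by
        rw [← tsum_mul_left]
        congr 1
        refine tsum_congr fun k ↦ ?_
        simp only [fwdDiff, add_assoc]
        ring

/-- **Iterated Abel summation**: for `z ≠ 1`, `‖z‖ = 1`, every `K`:
`Σ' w(m₀+k)z^{m₀+k} = (Σ_{j<K} (z/(1−z))^j (Δ^j w)(m₀)) z^{m₀}/(1−z) + (z/(1−z))^K Σ' (Δ^K w)(m₀+k) z^{m₀+k}`. -/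
theorem abel_iter (hz : ‖z‖ = 1) (hz1 : z ≠ 1) (hw : Summable fun n ↦ ‖w n‖) (m₀ K : ℕ) :
    ∑' k, w (m₀ + k) * z ^ (m₀ + k)
      = (∑ j ∈ Finset.range K, (z / (1 - z)) ^ j * ((Δ_[1])^[j] w) m₀) * z ^ m₀ / (1 - z)
        + (z / (1 - z)) ^ K * ∑' k, ((Δ_[1])^[K] w) (m₀ + k) * z ^ (m₀ + k) := by
  have h1z : (1 - z) ≠ 0 := sub_ne_zero.mpr (Ne.symm hz1)
  induction K with
  | zero => simp
  | succ K ih =>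
    -- Abel step on `Δ^K w` (absolutely summable)
    have hwK : Summable fun n ↦ ‖((Δ_[1])^[K] w) n‖ := by
      simpa using summable_norm_fwdDiff_iter_shift hw K 0
    have hstep := abel_step hz hwK m₀
    -- `T(Δ^K w) = (Δ^K w m₀ z^m₀ + z T(Δ^{K+1} w))/(1 - z)`
    have hT : ∑' k, ((Δ_[1])^[K] w) (m₀ + k) * z ^ (m₀ + k)
        = (((Δ_[1])^[K] w) m₀ * z ^ m₀ + z * ∑' k, ((Δ_[1])^[K + 1] w) (m₀ + k) * z ^ (m₀ + k)) / (1 - z) := by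
      rw [eq_div_iff h1z, mul_comm]
      rw [hstep]
      simp only [Function.iterate_succ_apply']
    rw [ih, hT, Finset.sum_range_succ]
    simp only [div_eq_mul_inv]
    ring

end Abel

/-! ## Telescoping bound for the remainder -/

section Telescope

/-- For a real sequence `u` with `σ·u` antitone beyond `m₀` (`σ = ±1`) and `u(m₀+k) → 0`:
`Σ'_k |u(m₀+k+1) − u(m₀+k)| = |u(m₀)|` (and the series is summable). -/
theorem tsum_abs_fwdDiff_eq_of_antitone {u : ℕ → ℝ} {σ : ℝ} (hσ : σ = 1 ∨ σ = -1) {m₀ : ℕ}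
    (hmono : ∀ k, σ * u (m₀ + k + 1) ≤ σ * u (m₀ + k)) (hlim : Tendsto (fun k ↦ u (m₀ + k)) atTop (𝓝 0)) :
    Summable (fun k ↦ |(Δ_[1] u) (m₀ + k)|) ∧ ∑' k, |(Δ_[1] u) (m₀ + k)| = |u m₀| := by
  have hσabs : |σ| = 1 := by rcases hσ with rfl | rfl <;> simp
  have habs : ∀ k, |(Δ_[1] u) (m₀ + k)| = σ * u (m₀ + k) - σ * u (m₀ + k + 1) := by
    intro k
    have h := hmono k
    have e : (Δ_[1] u) (m₀ + k) = u (m₀ + k + 1) - u (m₀ + k) := by simp only [fwdDiff, add_assoc]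
    rw [e]
    rcases hσ with rfl | rfl
    · rw [one_mul, one_mul] at h ⊢; rw [abs_of_nonpos (by linarith)]; ring
    · simp only [neg_mul, one_mul, neg_le_neg_iff] at h; rw [abs_of_nonneg (by linarith)]; ring
  have hpart : ∀ n, ∑ k ∈ Finset.range n, |(Δ_[1] u) (m₀ + k)| = σ * u m₀ - σ * u (m₀ + n) := by
    intro n
    simp_rw [habs]
    have h := Finset.sum_range_sub' (fun k ↦ σ * u (m₀ + k)) n
    simp only [add_zero] at h
    rw [← h]
    refine Finset.sum_congr rfl fun k _ ↦ by simp only [add_assoc]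
  have hlimP : Tendsto (fun n ↦ ∑ k ∈ Finset.range n, |(Δ_[1] u) (m₀ + k)|) atTop (𝓝 (σ * u m₀)) := by
    have h : Tendsto (fun n ↦ σ * u m₀ - σ * u (m₀ + n)) atTop (𝓝 (σ * u m₀ - σ * 0)) :=
      tendsto_const_nhds.sub (hlim.const_mul σ)
    rw [mul_zero, sub_zero] at h
    exact h.congr fun n ↦ (hpart n).symm
  have hnn : ∀ k, 0 ≤ |(Δ_[1] u) (m₀ + k)| := fun k ↦ abs_nonneg _
  have hmonoP : Monotone fun n ↦ ∑ k ∈ Finset.range n, |(Δ_[1] u) (m₀ + k)| :=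
    monotone_nat_of_le_succ fun n ↦ by rw [Finset.sum_range_succ]; linarith [hnn n]
  have hle : ∀ n, ∑ k ∈ Finset.range n, |(Δ_[1] u) (m₀ + k)| ≤ σ * u m₀ := fun n ↦ hmonoP.ge_of_tendsto hlimP n
  have hsum : Summable fun k ↦ |(Δ_[1] u) (m₀ + k)| := summable_of_sum_range_le hnn hle
  refine ⟨hsum, ?_⟩
  have hval : ∑' k, |(Δ_[1] u) (m₀ + k)| = σ * u m₀ := tendsto_nhds_unique hsum.hasSum.tendsto_sum_nat hlimP
  have h0 : 0 ≤ σ * u m₀ := by rw [← hval]; exact tsum_nonneg hnn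
  rw [hval, ← abs_of_nonneg h0, abs_mul, hσabs, one_mul]

end Telescope

/-! ## Complete monotonicity of `m ↦ 1/m^s` -/

section CM

/-- The weight `u_s(n) = 1/n^s`. We write it inline as `fun n : ℕ ↦ 1 / (n : ℝ) ^ s`. -/
theorem neg_one_pow_mul_fwdDiff_iter_inv_pow (s K m : ℕ) :
    (-1 : ℝ) ^ K * ((Δ_[1])^[K] (fun n : ℕ ↦ 1 / (n : ℝ) ^ s)) m
      = ∑ j ∈ Finset.range (K + 1), (-1 : ℝ) ^ j * (K.choose j : ℝ) / ((m : ℝ) + j) ^ s := by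
  rw [fwdDiff_iter_eq_sum_shift, Finset.mul_sum]
  refine Finset.sum_congr rfl fun j hj ↦ ?_
  have hjK : j ≤ K := Nat.lt_succ_iff.mp (Finset.mem_range.mp hj)
  rw [zsmul_eq_mul, smul_eq_mul, mul_one]
  push_cast
  have : (-1 : ℝ) ^ K * (-1) ^ (K - j) = (-1) ^ j := by
    rw [← pow_add, show K + (K - j) = j + 2 * (K - j) by omega, pow_add, pow_mul]; norm_num
  rw [← mul_assoc, ← mul_assoc, this]
  ring

/-- Integrability of `t ↦ t^{s−1} e^{−rt} (1 − e^{−t})^K` on `(0, ∞)` for `s ≥ 1`, `r ≥ 1` (dominated by the Gamma integrand). -/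
theorem integrableOn_gammaKernel {s : ℕ} (hs : 1 ≤ s) {r : ℝ} (hr : 1 ≤ r) (K : ℕ) :
    IntegrableOn (fun t : ℝ ↦ t ^ (s - 1) * Real.exp (-(r * t)) * (1 - Real.exp (-t)) ^ K) (Ioi 0) := by
  have hG := Real.GammaIntegral_convergent (s := (s : ℝ)) (by exact_mod_cast hs)
  refine Integrable.mono' hG ?_ ?_
  · refine ContinuousOn.aestronglyMeasurable ?_ measurableSet_Ioi
    exact ((continuous_pow _).mul (by fun_prop)).mul (by fun_prop) |>.continuousOn
  · refine (ae_restrict_iff' measurableSet_Ioi).2 (Filter.Eventually.of_forall fun t ht ↦ ?_)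
    have ht0 : 0 < t := ht
    have h1 : 0 ≤ 1 - Real.exp (-t) := by
      have : Real.exp (-t) ≤ 1 := by rw [Real.exp_le_one_iff]; linarith
      linarith
    have h2 : 1 - Real.exp (-t) ≤ 1 := by linarith [Real.exp_pos (-t)]
    have hpowK : (1 - Real.exp (-t)) ^ K ≤ 1 := pow_le_one₀ h1 h2
    have hexp : Real.exp (-(r * t)) ≤ Real.exp (-t) := Real.exp_le_exp.2 (by nlinarith)
    rw [Real.norm_eq_abs, abs_of_nonneg (by positivity)]
    have hts : (t : ℝ) ^ (s - 1) = t ^ ((s : ℝ) - 1) := by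
      rw [← Real.rpow_natCast, Nat.cast_sub hs, Nat.cast_one]
    rw [hts]
    calc t ^ ((s : ℝ) - 1) * Real.exp (-(r * t)) * (1 - Real.exp (-t)) ^ K
        ≤ t ^ ((s : ℝ) - 1) * Real.exp (-t) * 1 := by gcongr
      _ = Real.exp (-t) * t ^ ((s : ℝ) - 1) := by ring

/-- **Integral representation**: for `s ≥ 1`, `m ≥ 1`,
`∫_0^∞ t^{s−1} e^{−mt}(1−e^{−t})^K dt = Γ(s)·Σ_{j≤K} (−1)^j C(K,j)/(m+j)^s` (`= Γ(s)·(−1)^K Δ^K(1/n^s)(m)`). -/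
theorem integral_gammaKernel_eq {s : ℕ} (hs : 1 ≤ s) (K : ℕ) {m : ℕ} (hm : 1 ≤ m) :
    ∫ t in Ioi (0 : ℝ), t ^ (s - 1) * Real.exp (-((m : ℝ) * t)) * (1 - Real.exp (-t)) ^ K
      = Real.Gamma s * ∑ j ∈ Finset.range (K + 1), (-1 : ℝ) ^ j * (K.choose j : ℝ) / ((m : ℝ) + j) ^ s := by
  have hm1 : (1 : ℝ) ≤ m := by exact_mod_cast hm
  -- expand `(1 − e^{−t})^K`
  have hexpand : ∀ t : ℝ, t ^ (s - 1) * Real.exp (-((m : ℝ) * t)) * (1 - Real.exp (-t)) ^ K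
      = ∑ j ∈ Finset.range (K + 1), (-1 : ℝ) ^ j * (K.choose j : ℝ) * (t ^ (s - 1) * Real.exp (-(((m : ℝ) + j) * t))) := by
    intro t
    rw [sub_eq_neg_add, add_pow, Finset.mul_sum]
    refine Finset.sum_congr rfl fun j _ ↦ ?_
    have e1 : (-Real.exp (-t)) ^ j = (-1) ^ j * Real.exp (-((j : ℝ) * t)) := by
      rw [neg_pow, ← Real.exp_nat_mul, show ((j : ℕ) : ℝ) * -t = -((j : ℝ) * t) by ring]
    have e2 : Real.exp (-((m : ℝ) * t)) * Real.exp (-((j : ℝ) * t)) = Real.exp (-(((m : ℝ) + j) * t)) := by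
      rw [← Real.exp_add]; ring_nf
    rw [e1, one_pow, mul_one]
    calc t ^ (s - 1) * Real.exp (-((m : ℝ) * t)) * ((-1) ^ j * Real.exp (-((j : ℝ) * t)) * (K.choose j : ℝ))
        = (-1) ^ j * (K.choose j : ℝ) * (t ^ (s - 1) * (Real.exp (-((m : ℝ) * t)) * Real.exp (-((j : ℝ) * t)))) := by
          ring
      _ = _ := by rw [e2]
  simp_rw [hexpand]
  rw [integral_finsetSum]
  · rw [Finset.mul_sum]
    refine Finset.sum_congr rfl fun j _ ↦ ?_
    rw [integral_const_mul]
    have hr : (0 : ℝ) < (m : ℝ) + j := by positivity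
    have hI := Real.integral_rpow_mul_exp_neg_mul_Ioi (a := (s : ℝ)) (by exact_mod_cast hs) hr
    have hts : ∀ t : ℝ, t ∈ Ioi (0:ℝ) → (t : ℝ) ^ (s - 1) = t ^ ((s : ℝ) - 1) := fun t ht ↦ by
      rw [← Real.rpow_natCast, Nat.cast_sub hs, Nat.cast_one]
    rw [setIntegral_congr_fun measurableSet_Ioi (fun t ht ↦ by rw [hts t ht]), hI, Real.rpow_natCast, div_pow, one_pow]
    field_simp
  · intro j _
    have h := integrableOn_gammaKernel hs (r := (m : ℝ) + j) (by linarith [(Nat.cast_nonneg j : (0:ℝ) ≤ j)]) 0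
    simp only [pow_zero, mul_one] at h
    exact h.const_mul _

/-- **Complete monotonicity of `1/n^s`**: `0 ≤ (−1)^K Δ^K (1/n^s)(m)` and it is antitone in `m ≥ 1` (`s ≥ 1`). -/
theorem fwdDiff_iter_inv_pow_sign {s : ℕ} (hs : 1 ≤ s) (K : ℕ) {m : ℕ} (hm : 1 ≤ m) :
    0 ≤ (-1 : ℝ) ^ K * ((Δ_[1])^[K] (fun n : ℕ ↦ 1 / (n : ℝ) ^ s)) m
      ∧ (-1 : ℝ) ^ K * ((Δ_[1])^[K] (fun n : ℕ ↦ 1 / (n : ℝ) ^ s)) (m + 1)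
          ≤ (-1 : ℝ) ^ K * ((Δ_[1])^[K] (fun n : ℕ ↦ 1 / (n : ℝ) ^ s)) m := by
  have hG : 0 < Real.Gamma s := Real.Gamma_pos_of_pos (by exact_mod_cast hs)
  have hrep : ∀ m' : ℕ, 1 ≤ m' → (-1 : ℝ) ^ K * ((Δ_[1])^[K] (fun n : ℕ ↦ 1 / (n : ℝ) ^ s)) m'
      = (∫ t in Ioi (0 : ℝ), t ^ (s - 1) * Real.exp (-((m' : ℝ) * t)) * (1 - Real.exp (-t)) ^ K) / Real.Gamma s := by
    intro m' hm'
    rw [neg_one_pow_mul_fwdDiff_iter_inv_pow, integral_gammaKernel_eq hs K hm', mul_div_cancel_left₀ _ hG.ne']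
  have hnn : ∀ (m' : ℕ) (t : ℝ), t ∈ Ioi (0:ℝ) → 0 ≤ t ^ (s - 1) * Real.exp (-((m' : ℝ) * t)) * (1 - Real.exp (-t)) ^ K := by
    intro m' t ht
    have ht0 : 0 < t := ht
    have h1 : 0 ≤ 1 - Real.exp (-t) := by
      have : Real.exp (-t) ≤ 1 := by rw [Real.exp_le_one_iff]; linarith
      linarith
    positivity
  refine ⟨?_, ?_⟩
  · rw [hrep m hm]
    exact div_nonneg (setIntegral_nonneg measurableSet_Ioi (hnn m)) hG.le
  · rw [hrep m hm, hrep (m + 1) (by omega)]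
    refine div_le_div_of_nonneg_right ?_ hG.le
    refine setIntegral_mono_on (integrableOn_gammaKernel hs (by push_cast; linarith) K)
      (integrableOn_gammaKernel hs (by exact_mod_cast hm) K) measurableSet_Ioi fun t ht ↦ ?_
    have ht0 : 0 < t := ht
    have h1 : 0 ≤ 1 - Real.exp (-t) := by
      have : Real.exp (-t) ≤ 1 := by rw [Real.exp_le_one_iff]; linarith
      linarith
    have hexp : Real.exp (-((((m + 1 : ℕ)) : ℝ) * t)) ≤ Real.exp (-((m : ℝ) * t)) := by
      apply Real.exp_le_exp.2; push_cast; nlinarith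
    gcongr

/-- `Δ^K (1/n^s)(m₀ + k) → 0` as `k → ∞` (`s ≥ 1`). -/
theorem tendsto_fwdDiff_iter_inv_pow {s : ℕ} (hs : 1 ≤ s) (K m₀ : ℕ) :
    Tendsto (fun k ↦ ((Δ_[1])^[K] (fun n : ℕ ↦ 1 / (n : ℝ) ^ s)) (m₀ + k)) atTop (𝓝 0) := by
  have h0 : Tendsto (fun k : ℕ ↦ 1 / ((m₀ + k : ℕ) : ℝ) ^ s) atTop (𝓝 0) := by
    have hadd : Tendsto (fun k : ℕ ↦ m₀ + k) atTop atTop := (tendsto_add_atTop_iff_nat m₀).2 tendsto_id |>.congr (fun k ↦ by simp [add_comm])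
    have h1 : Tendsto (fun k : ℕ ↦ ((m₀ + k : ℕ) : ℝ) ^ s) atTop atTop :=
      (tendsto_pow_atTop (by omega)).comp (tendsto_natCast_atTop_atTop.comp hadd)
    have h2 := h1.inv_tendsto_atTop
    refine h2.congr fun k ↦ ?_
    simp [one_div]
  have hrepr : ∀ k, ((Δ_[1])^[K] (fun n : ℕ ↦ 1 / (n : ℝ) ^ s)) (m₀ + k)
      = ∑ j ∈ Finset.range (K + 1), (((-1 : ℤ) ^ (K - j) * K.choose j : ℤ) : ℝ) * (1 / (((m₀ + (k + j)) : ℕ) : ℝ) ^ s) := by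
    intro k
    rw [fwdDiff_iter_eq_sum_shift]
    refine Finset.sum_congr rfl fun j _ ↦ ?_
    rw [zsmul_eq_mul, smul_eq_mul, mul_one]; push_cast; ring_nf
  simp_rw [hrepr]
  have : Tendsto (fun k ↦ ∑ j ∈ Finset.range (K + 1),
      (((-1 : ℤ) ^ (K - j) * K.choose j : ℤ) : ℝ) * (1 / (((m₀ + (k + j)) : ℕ) : ℝ) ^ s)) atTop
      (𝓝 (∑ j ∈ Finset.range (K + 1), (((-1 : ℤ) ^ (K - j) * K.choose j : ℤ) : ℝ) * 0)) := by
    refine tendsto_finsetSum _ fun j _ ↦ (Tendsto.const_mul _ ?_)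
    have := h0.comp (tendsto_add_atTop_nat j)
    refine this.congr fun k ↦ ?_
    simp only [Function.comp]
  simpa using this

end CM

/-! ## The box for `Σ_{m≥m₀} z^m/m^s` -/

section Box

/-- Casting commutes with iterated forward differences. -/
theorem fwdDiff_iter_ofReal (u : ℕ → ℝ) (K m : ℕ) :
    ((Δ_[1])^[K] (fun n ↦ ((u n : ℝ) : ℂ))) m = ((((Δ_[1])^[K] u) m : ℝ) : ℂ) := by
  induction K generalizing u m with
  | zero => simp
  | succ K ih =>
    simp only [Function.iterate_succ_apply]
    have : (Δ_[1] fun n ↦ ((u n : ℝ) : ℂ)) = fun n ↦ (((Δ_[1] u) n : ℝ) : ℂ) := by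
      funext n; simp [fwdDiff]
    rw [this, ih]

/-- **Iterated-Abel box for the oscillatory power tail.**  For `‖z‖ = 1`, `z ≠ 1`, `2 ≤ s`, `1 ≤ m₀`, `1 ≤ K`,
with `u(n) = 1/n^s`:
`‖Σ'_k u(m₀+k) z^{m₀+k} − (Σ_{j<K} (z/(1−z))^j (Δ^j u)(m₀))·z^{m₀}/(1−z)‖ ≤ |(Δ^{K−1} u)(m₀)| / ‖1 − z‖^K`. -/
theorem norm_oscTail_inv_pow_sub_abel_le {z : ℂ} (hz : ‖z‖ = 1) (hz1 : z ≠ 1) {s : ℕ} (hs : 2 ≤ s)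
    {m₀ : ℕ} (hm₀ : 1 ≤ m₀) {K : ℕ} (hK : 1 ≤ K) :
    ‖(∑' k, (((1 / (((m₀ + k : ℕ)) : ℝ) ^ s : ℝ)) : ℂ) * z ^ (m₀ + k))
        - (∑ j ∈ Finset.range K, (z / (1 - z)) ^ j *
            (((((Δ_[1])^[j] (fun n : ℕ ↦ 1 / (n : ℝ) ^ s)) m₀ : ℝ)) : ℂ)) * z ^ m₀ / (1 - z)‖
      ≤ |((Δ_[1])^[K - 1] (fun n : ℕ ↦ 1 / (n : ℝ) ^ s)) m₀| / ‖1 - z‖ ^ K := by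
  set u : ℕ → ℝ := fun n ↦ 1 / (n : ℝ) ^ s with hu
  set w : ℕ → ℂ := fun n ↦ ((u n : ℝ) : ℂ) with hw
  have hws : Summable fun n ↦ ‖w n‖ := by
    have h := Real.summable_one_div_nat_pow.mpr (by omega : 1 < s)
    refine h.norm.congr fun n ↦ ?_
    simp only [hw, hu, Complex.norm_real]
  have hid := abel_iter hz hz1 hws m₀ K
  have hΔ : ∀ j m, ((Δ_[1])^[j] w) m = ((((Δ_[1])^[j] u) m : ℝ) : ℂ) := fun j m ↦ fwdDiff_iter_ofReal u j m
  -- rewrite the statement's series as `Σ' w(m₀+k) z^{m₀+k}`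
  have hser : (∑' k, (((1 / (((m₀ + k : ℕ)) : ℝ) ^ s : ℝ)) : ℂ) * z ^ (m₀ + k)) = ∑' k, w (m₀ + k) * z ^ (m₀ + k) := by
    rfl
  rw [hser, hid]
  simp_rw [hΔ]
  rw [add_sub_cancel_left, norm_mul, norm_pow, norm_div, hz]
  have h1z : 0 < ‖1 - z‖ := norm_pos_iff.mpr (sub_ne_zero.mpr (Ne.symm hz1))
  -- the remainder series: `Σ' |Δ^K u(m₀+k)| = |Δ^{K-1} u(m₀)|`
  obtain ⟨K', rfl⟩ : ∃ K', K = K' + 1 := ⟨K - 1, by omega⟩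
  simp only [Nat.add_sub_cancel]
  have hsign := fun k ↦ fwdDiff_iter_inv_pow_sign (le_trans (by norm_num) hs) K' (m := m₀ + k) (by omega)
  set σ : ℝ := (-1 : ℝ) ^ K' with hσ
  have hσ1 : σ = 1 ∨ σ = -1 := by
    rcases Nat.even_or_odd K' with h | h
    · left; simp [hσ, h.neg_one_pow]
    · right; simp [hσ, h.neg_one_pow]
  have hmono : ∀ k, σ * ((Δ_[1])^[K'] u) (m₀ + k + 1) ≤ σ * ((Δ_[1])^[K'] u) (m₀ + k) := fun k ↦ (hsign k).2
  have hlim := tendsto_fwdDiff_iter_inv_pow (by omega : 1 ≤ s) K' m₀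
  obtain ⟨hsum, hval⟩ := tsum_abs_fwdDiff_eq_of_antitone hσ1 hmono hlim
  -- `‖Σ' (Δ^{K'+1} u)(m₀+k) z^{m₀+k}‖ ≤ Σ' |Δ(Δ^{K'} u)(m₀+k)| = |Δ^{K'} u(m₀)|`
  have hnormsum : Summable fun k ↦ ‖((((Δ_[1])^[K' + 1] u) (m₀ + k) : ℝ) : ℂ)‖ := by
    refine hsum.congr fun k ↦ ?_
    rw [Complex.norm_real, Real.norm_eq_abs, Function.iterate_succ_apply']
  have hT := norm_tsum_shift_mul_pow_le hz (v := fun n ↦ ((((Δ_[1])^[K' + 1] u) n : ℝ) : ℂ)) (m₀ := m₀) hnormsum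
  have hTval : ∑' k, ‖((((Δ_[1])^[K' + 1] u) (m₀ + k) : ℝ) : ℂ)‖ = |((Δ_[1])^[K'] u) m₀| := by
    rw [← hval]
    refine tsum_congr fun k ↦ ?_
    rw [Complex.norm_real, Real.norm_eq_abs, Function.iterate_succ_apply']
  rw [hTval] at hT
  calc (1 / ‖1 - z‖) ^ (K' + 1) * ‖∑' k, ((((Δ_[1])^[K' + 1] u) (m₀ + k) : ℝ) : ℂ) * z ^ (m₀ + k)‖
      ≤ (1 / ‖1 - z‖) ^ (K' + 1) * |((Δ_[1])^[K'] u) m₀| := by gcongr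
    _ = |((Δ_[1])^[K'] u) m₀| / ‖1 - z‖ ^ (K' + 1) := by
        rw [div_pow, one_pow]; ring

end Box

end Summit.RiemannHypothesis.RiemannHypothesis.Theorems.WeilFormatC

end
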